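import Literature.MathematicalPhysics.KineticTheory.HardSphereEulerPrimitiveForm
import Literature.MathematicalPhysics.KineticTheory.HardSphereEulerLocalTheoryProofs
import Literature.Analysis.FunctionSpaces.TorusSpaceTime
import HarnessLib

/-!
# The pointwise Euler cancellation of the relative-entropy clock (stub `stub_cancellation`)

Crux `Summit.AtomisticToContinuum.HydrodynamicLimit.Theses.OneFlightGossipEngine.ClampedCurrentsDock`
(stmt-AtomisticToContinuum-14680), line `IdeatorTwoSketch`, stub S8
`stub_cancellation : EulerCancellation` — the algebraic heart of Yau's relative-entropy ledger for hard
spheres. Along a classical hs-Euler solution at packing `η = ρσ³` inside the analyticity window of the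
equation of state (`Z = hsCompressibility = 1 + ηF′`, `F` real-analytic) and for an insertion factor `Rf`
with `(log Rf)′ = 2F′ + ηF″` (the conclusion of S4, `EosConsistency`), the reference activity
`a_t = ρ_t · Rf(σ³ρ_t)` makes the streaming rate `Dg = (∂_t + v·∇)g` of the local-Gibbs exponent
`g = log a − (3/2) log(2πθ) − |v − u|²/(2θ)` PLUS the per-particle integrands of the local EOS projections
(momentum rows at `φ_k = u_k/θ`, energy row at `φ_e = −θ⁻¹`) equal to the fast kinetic currents alone
(traceless stress + fast heat flux): no affine term in `1, w, |w|²` survives. The statement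
`EulerCancellation` is re-declared verbatim from the line skeleton.

## Proof

The streaming identity of S3 (`ClampedCurrentsDockStreaming.stub_streaming`; a private copy `streaming` is
kept here so that the file elaborates over Literature alone) is applied with the
TRIVIAL activity `a = 1` and the pressure law `ζ r = Z(rσ³)` (`hsPressure` unfolds to `ρθZ(ρσ³)`; `ζ` is
smooth on the open preimage of `(0, η₁)` because `Z = 1 + ηF′` there with `F` analytic). The exponent of the
statement differs from the one of `a = 1` by the additive field `log a = log(ρ Rf(σ³ρ))`, whose FIRST
derivatives at `(t, x)` exist by the chain rule (`ρ` smooth, `log Rf` differentiable on `(0, η₁)`):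
`∂ log a = (1/ρ + σ³ (log Rf)′(η)) ∂ρ`; no joint smoothness of `a` is needed. With the mass equation
`∂_t ρ = −ρ div u − u·∇ρ` (`IsHardSphereEulerSolution.timeDeriv_density_eq`), `Z = 1 + ηF′`,
`Z′ = F′ + ηF″` (`Filter.EventuallyEq.deriv_eq` on the open window), `ζ′(ρ) = σ³ Z′(η)` and
`Σ_k ∂_k(u_k/θ) = div u/θ − u·∇θ/θ²`, everything is a rational identity closed by `field_simp; ring`.
-/

noncomputable section

namespace Summit.AtomisticToContinuum.HydrodynamicLimit.Theorems.ClampedCurrentsDockCancellation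

open scoped BigOperators
open MeasureTheory Filter Set Topology
open Literature.MathematicalPhysics.KineticTheory Literature.Analysis.FluidPDE Literature.Analysis.FunctionSpaces
open Literature.MathematicalPhysics.KineticTheory.HsEulerCalc

/-! ## The statement (verbatim from the line skeleton) -/

/-- **S8 — the Euler cancellation, pointwise (algebraic heart of the ledger; worker-sized).** For a classical
hs-Euler solution at packing inside the analyticity window of the EOS, with the canonical compressibility
`Z = 1 + ηF′` and an insertion factor satisfying the conclusion of S4 (`(log Rf)′ = 2F′ + ηF″`), the reference
activity `a_t = ρ_t·Rf(σ³ρ_t)` makes the streaming rate of the local-Gibbs exponent PLUS the per-particle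
integrands of the local EOS projections (momentum rows at `φ_k = u_k/θ`, energy row at `φ_e = −θ⁻¹`, i.e.
`∇φ_e = ∇θ/θ²`) equal to the FAST kinetic currents alone:
`Dg + Σ_k ∂_k(u_k/θ)[θηZ′ + (Z−1)|w|²/3] + (u·∇θ/θ²)[θηZ′ + (Z−1)|w|²/3] + (Z−1)(w·∇θ)/θ
 = θ⁻¹Σ_{j,k}(w_jw_k − δ_{jk}|w|²/3)∂_ku_j + (|w|² − 5θ)(w·∇θ)/(2θ²)` — the affine coefficients of `1, w, |w|²`
vanish IDENTICALLY (S3 + `∇log a = (Z+ηZ′)∇ρ/ρ`, `∂_t log a + u·∇log a = −(Z+ηZ′)div u`). -/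
def EulerCancellation : Prop :=
  ∀ (σ T η₁ : ℝ) (ρ θ : ℝ → T3 → ℝ) (u : ℝ → T3 → V3) (F Rf : ℝ → ℝ),
    IsHardSphereEulerSolution σ T ρ u θ → 0 < σ → 0 < η₁ → AnalyticOnNhd ℝ F (Ioo (-η₁) η₁) →
    (∀ η ∈ Ioo 0 η₁, hsCompressibility η = 1 + η * deriv F η) →
    (∀ η ∈ Ioo 0 η₁, 0 < Rf η ∧ DifferentiableAt ℝ (fun x => Real.log (Rf x)) η ∧
      deriv (fun x => Real.log (Rf x)) η = 2 * deriv F η + η * deriv (deriv F) η) →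
    (∀ t ∈ Ico 0 T, ∀ x, ρ t x * σ ^ 3 ∈ Ioo 0 η₁) →
    ∀ t ∈ Ico 0 T, ∀ (x : T3) (v : V3),
      (let a := fun (t : ℝ) (y : T3) => ρ t y * Rf (σ ^ 3 * ρ t y)
       let g := fun (t : ℝ) (y : T3 × V3) =>
         Real.log (a t y.1) - 3 / 2 * Real.log (2 * Real.pi * θ t y.1) - ‖y.2 - u t y.1‖ ^ 2 / (2 * θ t y.1)
       let w : V3 := v - u t x
       let Z : ℝ := hsCompressibility (ρ t x * σ ^ 3)
       let Z' : ℝ := deriv hsCompressibility (ρ t x * σ ^ 3)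
       let dθ := fun k : Fin 3 => Torus.partialDeriv k (θ t) x
       let du := fun (k j : Fin 3) => Torus.partialDeriv k (fun y => u t y j) x
       Torus.timeDerivWithin (Ico 0 T) (fun t' y => g t' (y, v)) t x +
           ∑ k : Fin 3, v k * Torus.partialDeriv k (fun y => g t (y, v)) x +
         (∑ k : Fin 3, Torus.partialDeriv k (fun y => u t y k / θ t y) x) *
           (θ t x * (ρ t x * σ ^ 3) * Z' + (1 / 3) * (Z - 1) * ‖w‖ ^ 2) +
         ((∑ k : Fin 3, u t x k * dθ k) / (θ t x) ^ 2) *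
           (θ t x * (ρ t x * σ ^ 3) * Z' + (1 / 3) * (Z - 1) * ‖w‖ ^ 2) +
         (Z - 1) * (∑ k : Fin 3, w k * dθ k) / θ t x =
       (θ t x)⁻¹ * ∑ j : Fin 3, ∑ k : Fin 3, (w j * w k - (if j = k then ‖w‖ ^ 2 / 3 else 0)) * du k j +
         (‖w‖ ^ 2 - 5 * θ t x) * (∑ k : Fin 3, w k * dθ k) / (2 * (θ t x) ^ 2))

/-! ## The streaming identity (private copy of `ClampedCurrentsDockStreaming.stub_streaming`) -/

/-- The traceless contraction written out: `Σ_{j,k} (w_j w_k − δ_{jk} c) M_{kj} = Σ_{j,k} w_j w_k M_{kj} − c Σ_k M_{kk}`.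
[folklore] -/
private theorem sum_traceless (w : V3) (c : ℝ) (M : Fin 3 → Fin 3 → ℝ) :
    ∑ j : Fin 3, ∑ k : Fin 3, (w j * w k - (if j = k then c else 0)) * M k j =
      ∑ j : Fin 3, ∑ k : Fin 3, w j * w k * M k j - c * ∑ k : Fin 3, M k k := by
  simp only [sub_mul, Finset.sum_sub_distrib, ite_mul, zero_mul, Finset.sum_ite_eq, Finset.mem_univ,
    if_true, Finset.mul_sum]

/-- **The Euler streaming identity in entropy variables** (statement and proof of the landed S3,
`ClampedCurrentsDockStreaming.stub_streaming`, private copy): for a classical hs-Euler solution with pressure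
`ρθζ(ρ)` and any jointly smooth activity `a > 0`, the streaming rate of
`g = log a − (3/2) log(2πθ) − |v − u|²/(2θ)` splits into the order-zero term, the activity bracket, the traceless
kinetic stress with the EOS counter-terms and the fast heat flux. [folklore] -/
private theorem streaming :
    ∀ (σ T : ℝ) (ρ θ : ℝ → T3 → ℝ) (u : ℝ → T3 → V3) (ζ : ℝ → ℝ) (J : Set ℝ) (a : ℝ → T3 → ℝ),
    IsHardSphereEulerSolution σ T ρ u θ → IsOpen J → ContDiffOn ℝ (⊤ : ℕ∞) ζ J →
    (∀ t ∈ Ico 0 T, ∀ x, ρ t x ∈ J) →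
    (∀ t ∈ Ico 0 T, ∀ x, hsPressure σ (ρ t x) (θ t x) = ρ t x * θ t x * ζ (ρ t x)) →
    Torus.IsSmoothSpaceTimeOn (Ico 0 T) a → (∀ t ∈ Ico 0 T, ∀ x, 0 < a t x) →
    ∀ t ∈ Ico 0 T, ∀ (x : T3) (v : V3),
      (let g := fun (t : ℝ) (y : T3 × V3) =>
         Real.log (a t y.1) - 3 / 2 * Real.log (2 * Real.pi * θ t y.1) - ‖y.2 - u t y.1‖ ^ 2 / (2 * θ t y.1)
       let w : V3 := v - u t x
       let dloga := fun k : Fin 3 => Torus.partialDeriv k (fun y => Real.log (a t y)) x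
       let dρ := fun k : Fin 3 => Torus.partialDeriv k (ρ t) x
       let dθ := fun k : Fin 3 => Torus.partialDeriv k (θ t) x
       let du := fun (k j : Fin 3) => Torus.partialDeriv k (fun y => u t y j) x
       let divu : ℝ := ∑ k : Fin 3, du k k
       Torus.timeDerivWithin (Ico 0 T) (fun t' y => g t' (y, v)) t x +
           ∑ k : Fin 3, v k * Torus.partialDeriv k (fun y => g t (y, v)) x =
         (Torus.timeDerivWithin (Ico 0 T) (fun t' y => Real.log (a t' y)) t x +
             ∑ k : Fin 3, u t x k * dloga k + ζ (ρ t x) * divu) +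
         (∑ k : Fin 3, w k * (dloga k - (ζ (ρ t x) + ρ t x * deriv ζ (ρ t x)) * dρ k / ρ t x) +
             (1 - ζ (ρ t x)) * (∑ k : Fin 3, w k * dθ k) / θ t x) +
         ((θ t x)⁻¹ * ∑ j : Fin 3, ∑ k : Fin 3,
               (w j * w k - (if j = k then ‖w‖ ^ 2 / 3 else 0)) * du k j +
             (1 - ζ (ρ t x)) * ‖w‖ ^ 2 * divu / (3 * θ t x)) +
         (‖w‖ ^ 2 - 5 * θ t x) * (∑ k : Fin 3, w k * dθ k) / (2 * (θ t x) ^ 2)) := by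
  intro σ T ρ θ u ζ J a hE hJ hζ hρJ hp ha ha0 t ht x v
  dsimp only
  rw [sum_traceless]
  have hU : UniqueDiffOn ℝ (Ico (0 : ℝ) T) := uniqueDiffOn_Ico 0 T
  -- smooth slices
  have hθ1 : Torus.IsContDiff 1 (θ t) := (hE.smooth_temperature.isSmooth_slice ht).isContDiff (by simp)
  have hu1 : Torus.IsContDiff 1 (u t) := (hE.smooth_velocity.isSmooth_slice ht).isContDiff (by simp)
  have huj1 : ∀ j, Torus.IsContDiff 1 (fun y => u t y j) := fun j => isContDiff_apply_coord hu1 j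
  -- `log a` is a jointly smooth field (`a > 0`)
  have hla : Torus.IsSmoothSpaceTimeOn (Ico 0 T) (fun s y => Real.log (a s y)) :=
    ContDiffOn.log ha fun p hp => (ha0 p.1 (mem_prod.1 hp).1 _).ne'
  have hla1 : Torus.IsContDiff 1 (fun y => Real.log (a t y)) := (hla.isSmooth_slice ht).isContDiff (by simp)
  -- positivity
  have hθ0 : ∀ y, θ t y ≠ 0 := fun y => (hE.temperature_pos t ht y).ne'
  have h2θ0 : ∀ y, 2 * θ t y ≠ 0 := fun y => mul_ne_zero two_ne_zero (hθ0 y)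
  have h2πθ0 : ∀ y, 2 * Real.pi * θ t y ≠ 0 := fun y =>
    (mul_pos Real.two_pi_pos (hE.temperature_pos t ht y)).ne'
  have hθx : θ t x ≠ 0 := hθ0 x
  have hρ0 : ρ t x ≠ 0 := (hE.density_pos t ht x).ne'
  have hπ0 : Real.pi ≠ 0 := Real.pi_pos.ne'
  -- coordinate-line derivatives of the basic fields at `x`
  have cA := fun k => hasDerivAt_coordLine hla1 x k
  have cθ := fun k => hasDerivAt_coordLine hθ1 x k
  have cu := fun k j => hasDerivAt_coordLine (huj1 j) x k
  -- time-slice derivatives at `x`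
  have sA := hla.hasDerivWithinAt_slice ht x
  have sθ := hE.smooth_temperature.hasDerivWithinAt_slice ht x
  have su := fun j => (hE.smooth_velocity.apply j).hasDerivWithinAt_slice ht x
  -- `|v - u|²` in coordinates
  have hnorm : ∀ (s : ℝ) (y : T3), ‖v - u s y‖ ^ 2 =
      (v 0 - u s y 0) ^ 2 + (v 1 - u s y 1) ^ 2 + (v 2 - u s y 2) ^ 2 := fun s y => by
    simp only [EuclideanSpace.norm_sq_eq, Fin.sum_univ_three, PiLp.sub_apply, Real.norm_eq_abs, sq_abs]
  simp only [hnorm, PiLp.sub_apply]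
  -- (1) the time derivative of `g`
  have hgt : Torus.timeDerivWithin (Ico 0 T) (fun t' y => Real.log (a t' y) -
      3 / 2 * Real.log (2 * Real.pi * θ t' y) -
      ((v 0 - u t' y 0) ^ 2 + (v 1 - u t' y 1) ^ 2 + (v 2 - u t' y 2) ^ 2) / (2 * θ t' y)) t x =
      Torus.timeDerivWithin (Ico 0 T) (fun t' y => Real.log (a t' y)) t x -
        3 / 2 * Torus.timeDerivWithin (Ico 0 T) θ t x / θ t x +
        ((v 0 - u t x 0) * Torus.timeDerivWithin (Ico 0 T) (fun s y => u s y 0) t x +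
          (v 1 - u t x 1) * Torus.timeDerivWithin (Ico 0 T) (fun s y => u s y 1) t x +
          (v 2 - u t x 2) * Torus.timeDerivWithin (Ico 0 T) (fun s y => u s y 2) t x) / θ t x +
        ((v 0 - u t x 0) ^ 2 + (v 1 - u t x 1) ^ 2 + (v 2 - u t x 2) ^ 2) *
          Torus.timeDerivWithin (Ico 0 T) θ t x / (2 * θ t x ^ 2) := by
    refine timeDerivWithin_eq_of_hasDerivWithinAt (((sA.fun_sub
      (((sθ.const_mul (2 * Real.pi)).log (h2πθ0 x)).const_mul (3 / 2))).fun_sub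
      ((((((su 0).const_sub (v 0)).fun_pow 2).fun_add (((su 1).const_sub (v 1)).fun_pow 2)).fun_add
        (((su 2).const_sub (v 2)).fun_pow 2)).fun_div (sθ.const_mul 2) (h2θ0 x))).congr_deriv ?_) (hU t ht)
    field_simp
    ring
  -- (2) the partial derivatives of `g`
  have hgk : ∀ k, Torus.partialDeriv k (fun y => Real.log (a t y) -
      3 / 2 * Real.log (2 * Real.pi * θ t y) -
      ((v 0 - u t y 0) ^ 2 + (v 1 - u t y 1) ^ 2 + (v 2 - u t y 2) ^ 2) / (2 * θ t y)) x =
      Torus.partialDeriv k (fun y => Real.log (a t y)) x -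
        3 / 2 * Torus.partialDeriv k (θ t) x / θ t x +
        ((v 0 - u t x 0) * Torus.partialDeriv k (fun y => u t y 0) x +
          (v 1 - u t x 1) * Torus.partialDeriv k (fun y => u t y 1) x +
          (v 2 - u t x 2) * Torus.partialDeriv k (fun y => u t y 2) x) / θ t x +
        ((v 0 - u t x 0) ^ 2 + (v 1 - u t x 1) ^ 2 + (v 2 - u t x 2) ^ 2) *
          Torus.partialDeriv k (θ t) x / (2 * θ t x ^ 2) := by
    intro k
    refine partialDeriv_eq_of_hasDerivAt ((((cA k).fun_sub
      ((((cθ k).const_mul (2 * Real.pi)).log (h2πθ0 _)).const_mul (3 / 2))).fun_sub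
      ((((((cu k 0).const_sub (v 0)).fun_pow 2).fun_add (((cu k 1).const_sub (v 1)).fun_pow 2)).fun_add
        (((cu k 2).const_sub (v 2)).fun_pow 2)).fun_div ((cθ k).const_mul 2) (h2θ0 _))).congr_deriv ?_)
    simp only [zero_smul, Torus.proj_zero, add_zero]
    field_simp
    ring
  rw [hgt]
  simp only [Fin.sum_univ_three, hgk]
  -- (3) the primitive equations
  have hP2 := fun j => hE.density_mul_timeDeriv_velocity_eq hJ hζ hρJ hp ht x j
  have hP3 := hE.timeDeriv_temperature_eq hJ hζ hρJ hp ht x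
  have hut : ∀ j, Torus.timeDerivWithin (Ico 0 T) (fun s y => u s y j) t x =
      (-(ρ t x * ∑ i, u t x i * Torus.partialDeriv i (fun y => u t y j) x) -
        (θ t x * (ζ (ρ t x) + ρ t x * deriv ζ (ρ t x)) * Torus.partialDeriv j (ρ t) x +
          ρ t x * ζ (ρ t x) * Torus.partialDeriv j (θ t) x)) / ρ t x := fun j =>
    eq_div_of_mul_eq hρ0 ((mul_comm _ _).trans (hP2 j))
  simp only [Fin.sum_univ_three] at hP3 hut
  rw [hP3, hut 0, hut 1, hut 2]
  field_simp
  ring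

/-! ## The stub -/

/-- **STUB `stub_cancellation`** of line `IdeatorTwoSketch` (crux `ClampedCurrentsDock`,
stmt-AtomisticToContinuum-14680): the pointwise Euler cancellation for the reference activity
`a = ρ Rf(σ³ρ)` — the streaming identity of S3 at `a = 1`, the chain rule for `log(ρ Rf(σ³ρ))`, the mass
equation and the EOS relations `Z = 1 + ηF′`, `Z′ = F′ + ηF″`, `(log Rf)′ = 2F′ + ηF″`. [folklore] -/
theorem stub_cancellation : EulerCancellation := by
  intro σ T η₁ ρ θ u F Rf hE hσ hη₁ hF hZ hRf hρσ t ht x v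
  dsimp only
  have hU : UniqueDiffOn ℝ (Ico (0 : ℝ) T) := uniqueDiffOn_Ico 0 T
  -- positivity at `(t, x)` and along the slices through it
  have hθx : θ t x ≠ 0 := (hE.temperature_pos t ht x).ne'
  have hρx : ρ t x ≠ 0 := (hE.density_pos t ht x).ne'
  have hθ0 : ∀ y, θ t y ≠ 0 := fun y => (hE.temperature_pos t ht y).ne'
  have hρ0 : ∀ y, ρ t y ≠ 0 := fun y => (hE.density_pos t ht y).ne'
  have hρ0' : ∀ τ ∈ Ico 0 T, ρ τ x ≠ 0 := fun τ hτ => (hE.density_pos τ hτ x).ne'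
  have hR0 : ∀ y, Rf (σ ^ 3 * ρ t y) ≠ 0 := fun y =>
    (hRf _ (by rw [mul_comm]; exact hρσ t ht y)).1.ne'
  have hR0' : ∀ τ ∈ Ico 0 T, Rf (σ ^ 3 * ρ τ x) ≠ 0 := fun τ hτ =>
    (hRf _ (by rw [mul_comm]; exact hρσ τ hτ x)).1.ne'
  -- the packing at `(t, x)` and the EOS data there
  have hmem : ρ t x * σ ^ 3 ∈ Ioo 0 η₁ := hρσ t ht x
  have hmemF : ρ t x * σ ^ 3 ∈ Ioo (-η₁) η₁ := ⟨by linarith [hmem.1], hmem.2⟩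
  obtain ⟨-, hRd, hRd'⟩ := hRf _ hmem
  -- `Z` is smooth on the window `(0, η₁)` (it is `1 + ηF′` there, `F` analytic)
  have hFan : AnalyticOnNhd ℝ (fun η => 1 + η * deriv F η) (Ioo 0 η₁) := fun η hη =>
    analyticAt_const.fun_add (analyticAt_id.fun_mul (hF.deriv η ⟨by linarith [hη.1], hη.2⟩))
  have hZs : ContDiffOn ℝ (⊤ : ℕ∞) hsCompressibility (Ioo 0 η₁) :=
    hFan.contDiffOn_of_completeSpace.congr fun η hη => hZ η hη
  -- the pressure law `ζ r = Z(rσ³)` on the open preimage `J` of the window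
  have hJ : IsOpen ((fun r : ℝ => r * σ ^ 3) ⁻¹' Ioo 0 η₁) :=
    isOpen_Ioo.preimage (continuous_id.mul continuous_const)
  have hζs : ContDiffOn ℝ (⊤ : ℕ∞) (fun r => hsCompressibility (r * σ ^ 3))
      ((fun r : ℝ => r * σ ^ 3) ⁻¹' Ioo 0 η₁) :=
    hZs.comp (contDiff_id.mul contDiff_const).contDiffOn fun r hr => hr
  have hp : ∀ s ∈ Ico 0 T, ∀ y, hsPressure σ (ρ s y) (θ s y) =
      ρ s y * θ s y * (fun r => hsCompressibility (r * σ ^ 3)) (ρ s y) := fun _ _ _ => rfl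
  have ha1 : Torus.IsSmoothSpaceTimeOn (Ico 0 T) (fun (_ : ℝ) (_ : T3) => (1 : ℝ)) := contDiffOn_const
  -- (1) the streaming identity at the trivial activity `a = 1`
  have E1 := streaming σ T ρ θ u (fun r => hsCompressibility (r * σ ^ 3))
    ((fun r : ℝ => r * σ ^ 3) ⁻¹' Ioo 0 η₁) (fun _ _ => (1 : ℝ)) hE hJ hζs (fun s hs y => hρσ s hs y) hp ha1
    (fun _ _ _ => one_pos) t ht x v
  dsimp only at E1
  -- (2) EOS relations at `(t, x)`: `Z = 1 + ηF′`, `Z′ = F′ + ηF″`, `ζ′(ρ) = σ³ Z′(η)`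
  have hZη : hsCompressibility (ρ t x * σ ^ 3) =
      1 + ρ t x * σ ^ 3 * deriv F (ρ t x * σ ^ 3) := hZ _ hmem
  have hZd : DifferentiableAt ℝ hsCompressibility (ρ t x * σ ^ 3) :=
    (hZs.differentiableOn (by simp)).differentiableAt (isOpen_Ioo.mem_nhds hmem)
  have hZ' : deriv hsCompressibility (ρ t x * σ ^ 3) =
      deriv F (ρ t x * σ ^ 3) + ρ t x * σ ^ 3 * deriv (deriv F) (ρ t x * σ ^ 3) := by
    have h1 : hsCompressibility =ᶠ[𝓝 (ρ t x * σ ^ 3)] fun z => 1 + z * deriv F z :=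
      eventuallyEq_of_mem (isOpen_Ioo.mem_nhds hmem) fun z hz => hZ z hz
    have h2 : HasDerivAt (deriv F) (deriv (deriv F) (ρ t x * σ ^ 3)) (ρ t x * σ ^ 3) :=
      (hF.deriv _ hmemF).differentiableAt.hasDerivAt
    rw [h1.deriv_eq, (((hasDerivAt_id' (ρ t x * σ ^ 3)).fun_mul h2).const_add 1).deriv]
    ring
  have hζ' : deriv (fun r => hsCompressibility (r * σ ^ 3)) (ρ t x) =
      σ ^ 3 * deriv hsCompressibility (ρ t x * σ ^ 3) := by
    have h := hZd.hasDerivAt.comp (ρ t x) ((hasDerivAt_id' (ρ t x)).mul_const (σ ^ 3))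
    rw [show (fun r => hsCompressibility (r * σ ^ 3)) = hsCompressibility ∘ fun r => r * σ ^ 3 from rfl,
      h.deriv]
    ring
  -- (3) smooth slices of the basic fields and their derivatives at `x`
  have hρ1 : Torus.IsContDiff 1 (ρ t) := (hE.smooth_density.isSmooth_slice ht).isContDiff (by simp)
  have hθ1 : Torus.IsContDiff 1 (θ t) := (hE.smooth_temperature.isSmooth_slice ht).isContDiff (by simp)
  have hu1 : Torus.IsContDiff 1 (u t) := (hE.smooth_velocity.isSmooth_slice ht).isContDiff (by simp)
  have huj1 : ∀ j, Torus.IsContDiff 1 (fun y => u t y j) := fun j => isContDiff_apply_coord hu1 j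
  have cρ := fun k => hasDerivAt_coordLine hρ1 x k
  have cθ := fun k => hasDerivAt_coordLine hθ1 x k
  have cu := fun k j => hasDerivAt_coordLine (huj1 j) x k
  have sρ := hE.smooth_density.hasDerivWithinAt_slice ht x
  -- (4) the exponent at `a = 1` is a jointly smooth field
  have hG : Torus.IsSmoothSpaceTimeOn (Ico 0 T) (fun t' y =>
      Real.log 1 - 3 / 2 * Real.log (2 * Real.pi * θ t' y) - ‖v - u t' y‖ ^ 2 / (2 * θ t' y)) := by
    have hpos : ∀ p ∈ Ico 0 T ×ˢ (univ : Set (EuclideanSpace ℝ (Fin 3))), 0 < Torus.stLift θ p :=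
      fun p hp => hE.temperature_pos p.1 (mem_prod.1 hp).1 _
    refine (contDiffOn_const.sub (contDiffOn_const.mul
      ((contDiffOn_const.mul hE.smooth_temperature).log fun p hp => ?_))).sub
      (((contDiffOn_const.sub hE.smooth_velocity).norm_sq ℝ).div
        (contDiffOn_const.mul hE.smooth_temperature) fun p hp => ?_)
    · exact (mul_pos Real.two_pi_pos (hpos p hp)).ne'
    · exact mul_ne_zero two_ne_zero (hpos p hp).ne'
  have hG1 : Torus.IsContDiff 1 (fun y =>
      Real.log 1 - 3 / 2 * Real.log (2 * Real.pi * θ t y) - ‖v - u t y‖ ^ 2 / (2 * θ t y)) :=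
    (hG.isSmooth_slice ht).isContDiff (by simp)
  have cG := fun k => hasDerivAt_coordLine hG1 x k
  have sG := hG.hasDerivWithinAt_slice ht x
  -- (5) first derivatives of `log a = log (ρ Rf(σ³ρ))` at `(t, x)` by the chain rule
  have sA : HasDerivWithinAt (fun τ => Real.log (ρ τ x * Rf (σ ^ 3 * ρ τ x)))
      (Torus.timeDerivWithin (Ico 0 T) ρ t x / ρ t x +
        deriv (fun z => Real.log (Rf z)) (ρ t x * σ ^ 3) * (σ ^ 3 * Torus.timeDerivWithin (Ico 0 T) ρ t x))
      (Ico 0 T) t := by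
    have h2 : HasDerivWithinAt (fun τ => Real.log (Rf (σ ^ 3 * ρ τ x)))
        (deriv (fun z => Real.log (Rf z)) (ρ t x * σ ^ 3) * (σ ^ 3 * Torus.timeDerivWithin (Ico 0 T) ρ t x))
        (Ico 0 T) t :=
      hRd.hasDerivAt.comp_hasDerivWithinAt_of_eq t (sρ.const_mul (σ ^ 3)) (mul_comm _ _)
    exact ((sρ.log (hρ0' t ht)).fun_add h2).congr_of_mem
      (fun τ hτ => Real.log_mul (hρ0' τ hτ) (hR0' τ hτ)) ht
  have cA : ∀ k, HasDerivAt (fun s : ℝ =>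
      Real.log (ρ t (x + Torus.proj (s • EuclideanSpace.single k (1 : ℝ))) *
        Rf (σ ^ 3 * ρ t (x + Torus.proj (s • EuclideanSpace.single k (1 : ℝ))))))
      (Torus.partialDeriv k (ρ t) x / ρ t x +
        deriv (fun z => Real.log (Rf z)) (ρ t x * σ ^ 3) * (σ ^ 3 * Torus.partialDeriv k (ρ t) x)) 0 := by
    intro k
    have h2 : HasDerivAt (fun s : ℝ =>
        Real.log (Rf (σ ^ 3 * ρ t (x + Torus.proj (s • EuclideanSpace.single k (1 : ℝ))))))
        (deriv (fun z => Real.log (Rf z)) (ρ t x * σ ^ 3) * (σ ^ 3 * Torus.partialDeriv k (ρ t) x)) 0 :=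
      hRd.hasDerivAt.comp_of_eq (0 : ℝ) ((cρ k).const_mul (σ ^ 3))
        (by simp only [zero_smul, Torus.proj_zero, add_zero]; ring)
    have hev : (fun s : ℝ =>
        Real.log (ρ t (x + Torus.proj (s • EuclideanSpace.single k (1 : ℝ))) *
          Rf (σ ^ 3 * ρ t (x + Torus.proj (s • EuclideanSpace.single k (1 : ℝ)))))) =ᶠ[𝓝 0]
        fun s => Real.log (ρ t (x + Torus.proj (s • EuclideanSpace.single k (1 : ℝ)))) +
          Real.log (Rf (σ ^ 3 * ρ t (x + Torus.proj (s • EuclideanSpace.single k (1 : ℝ))))) :=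
      Eventually.of_forall fun s => Real.log_mul (hρ0 _) (hR0 _)
    refine ((((cρ k).log (hρ0 _)).fun_add h2).congr_of_eventuallyEq hev).congr_deriv ?_
    simp only [zero_smul, Torus.proj_zero, add_zero]
  -- (6) the exponent of the statement is `log a +` (the exponent at `a = 1`)
  have hfun1 : (fun (t' : ℝ) (y : T3) => Real.log (ρ t' y * Rf (σ ^ 3 * ρ t' y)) -
      3 / 2 * Real.log (2 * Real.pi * θ t' y) - ‖v - u t' y‖ ^ 2 / (2 * θ t' y)) =
      fun t' y => Real.log (ρ t' y * Rf (σ ^ 3 * ρ t' y)) +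
        (Real.log 1 - 3 / 2 * Real.log (2 * Real.pi * θ t' y) - ‖v - u t' y‖ ^ 2 / (2 * θ t' y)) := by
    funext t' y; rw [Real.log_one]; ring
  have hfun2 : (fun (y : T3) => Real.log (ρ t y * Rf (σ ^ 3 * ρ t y)) -
      3 / 2 * Real.log (2 * Real.pi * θ t y) - ‖v - u t y‖ ^ 2 / (2 * θ t y)) =
      fun y => Real.log (ρ t y * Rf (σ ^ 3 * ρ t y)) +
        (Real.log 1 - 3 / 2 * Real.log (2 * Real.pi * θ t y) - ‖v - u t y‖ ^ 2 / (2 * θ t y)) := by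
    funext y; rw [Real.log_one]; ring
  have hT : Torus.timeDerivWithin (Ico 0 T) (fun t' y => Real.log (ρ t' y * Rf (σ ^ 3 * ρ t' y)) +
      (Real.log 1 - 3 / 2 * Real.log (2 * Real.pi * θ t' y) - ‖v - u t' y‖ ^ 2 / (2 * θ t' y))) t x =
      (Torus.timeDerivWithin (Ico 0 T) ρ t x / ρ t x +
        deriv (fun z => Real.log (Rf z)) (ρ t x * σ ^ 3) * (σ ^ 3 * Torus.timeDerivWithin (Ico 0 T) ρ t x)) +
      Torus.timeDerivWithin (Ico 0 T) (fun t' y =>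
        Real.log 1 - 3 / 2 * Real.log (2 * Real.pi * θ t' y) - ‖v - u t' y‖ ^ 2 / (2 * θ t' y)) t x :=
    timeDerivWithin_eq_of_hasDerivWithinAt (sA.fun_add sG) (hU t ht)
  have hX : ∀ k, Torus.partialDeriv k (fun y => Real.log (ρ t y * Rf (σ ^ 3 * ρ t y)) +
      (Real.log 1 - 3 / 2 * Real.log (2 * Real.pi * θ t y) - ‖v - u t y‖ ^ 2 / (2 * θ t y))) x =
      (Torus.partialDeriv k (ρ t) x / ρ t x +
        deriv (fun z => Real.log (Rf z)) (ρ t x * σ ^ 3) * (σ ^ 3 * Torus.partialDeriv k (ρ t) x)) +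
      Torus.partialDeriv k (fun y =>
        Real.log 1 - 3 / 2 * Real.log (2 * Real.pi * θ t y) - ‖v - u t y‖ ^ 2 / (2 * θ t y)) x :=
    fun k => partialDeriv_eq_of_hasDerivAt ((cA k).fun_add (cG k))
  -- (7) the EOS-projection integrands: `∂_k(u_k/θ) = (∂_k u_k θ − u_k ∂_k θ)/θ²`
  have hdiv : ∀ k, Torus.partialDeriv k (fun y => u t y k / θ t y) x =
      (Torus.partialDeriv k (fun y => u t y k) x * θ t x - u t x k * Torus.partialDeriv k (θ t) x) /
        θ t x ^ 2 := fun k =>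
    partialDeriv_eq_of_hasDerivAt (((cu k k).fun_div (cθ k) (hθ0 _)).congr_deriv
      (by simp only [zero_smul, Torus.proj_zero, add_zero]))
  -- (8) derivatives of the constant `log 1` and the mass equation
  have hc1 : Torus.timeDerivWithin (Ico 0 T) (fun (_ : ℝ) (_ : T3) => Real.log 1) t x = 0 :=
    timeDerivWithin_eq_of_hasDerivWithinAt (hasDerivWithinAt_const t (Ico 0 T) (Real.log 1)) (hU t ht)
  have hc2 : ∀ k, Torus.partialDeriv k (fun (_ : T3) => Real.log 1) x = 0 := fun k =>
    partialDeriv_eq_of_hasDerivAt (hasDerivAt_const (0 : ℝ) (Real.log 1))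
  have hP1 := hE.timeDeriv_density_eq ht x
  -- (9) assemble: everything is now a rational identity in the point values
  rw [hfun1, hfun2, hT]
  simp only [hX, hdiv]
  rw [sum_traceless] at E1 ⊢
  simp only [hc1, hc2] at E1
  simp only [Fin.sum_univ_three, PiLp.sub_apply] at E1 hP1 ⊢
  rw [hζ', hZ', hZη] at E1
  rw [hZ', hZη, hRd', hP1]
  linear_combination (norm := skip) E1
  field_simp
  ring

end Summit.AtomisticToContinuum.HydrodynamicLimit.Theorems.ClampedCurrentsDockCancellation

end
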